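import Literature.Barriers.ValiantsHypothesis.NotViaSaturationsChowNormal
import Literature.Barriers.ValiantsHypothesis.NotViaSaturationsThm3
import Literature.Computability.AlgebraicComplexity.ChowPlethysmBridge
import HarnessLib

/-!
# Not via saturations — BHI Prop. 1 (group part) for the Chow variety and Lemma 6, proved

Bürgisser–Hüttenhain–Ikenmeyer, *Permanent versus determinant: not via saturations*, Proc. AMS 145
(2017) = arXiv:1501.05528. `NotViaSaturationsChowNormal.lean` vendored the two uses of §2 Prop. 1
("We have `A(S(Z̃)) = A(S(Z))` and `Sat(S(Z̃)) = Sat(S(Z))`" for the normalisation `Z̃ → Z`) made in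
§3 for `Z = Chow_n`, `Z̃ = V^n // H_n` (Lemma 3, Brion), with `S(V^n // H_n)` replaced by its Lemma-4
description `normChowWeights n` (weights `χ` with `n ∣ |χ|` whose dual has a highest-weight vector
among the polynomial functions on `Sym^{|χ|/n} ℂ^n`, `symSymOcc`). The sibling
`NotViaSaturationsChowNormalProofs.lean` discharges the cone part `BHI2017_prop1_cone` (with a transfer
map written out in place). This file DISCHARGES the group part `BHI2017_prop1_group` ("Proposition 1
tells us that `A` equals the group generated by the monoid `S(V^n // H_n)`";
`BHI2017_prop1_group_holds`) — which needs BOTH inclusions `S(Chow_n) ⊆ S(V^n // H_n) ⊆ A(S(Chow_n))`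
at the level of highest-weight vectors, for every `n ≥ 1` — and Lemma 6 (`BHI2017_lemma6`:
"`λ^{(k)}` occurs in `Sym^n Sym^k V`"; `BHI2017_lemma6_holds`).

**Proof.** The tree proves Brion's theorem for `ψ_n : V^n // H_n → Chow_n`
(`exists_symBalanced_subset_range`, `ChowNormalization.lean`) and from it Prop. 1's two sentences in
the `formsRep` model of `𝒪(V^n // H_n) = ⊕_δ symBalanced n δ` (`mem_closure_chowOccWeights_of_isRealized`,
`nsmul_mem_chowOccWeights_of_isRealized`, `NotViaSaturationsThm3.lean`; this replaces the printed
route through Lemma 1, `Frac(𝒪(Z)^U) = ℂ(Z)^U`). The named facts are stated in the `coordRep` model;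
the plethysm bridge `Θ : k[Sym^δ ℂ^n]_n ≅ 𝒪(V^n // H_n)_δ` with inverse `Ξ` of
`Literature/Computability/AlgebraicComplexity/ChowPlethysmBridge.lean` identifies the two models in
both directions (`isRealized_of_mem_highestWeightSpace_coordRep`,
`exists_mem_highestWeightSpace_coordRep_of_isRealized`). What remains is bookkeeping:
* `S(Chow_n) ⊆ S(V^n // H_n)` (`chowOccWeights_subset_normChowWeights`, BHI §2: "`S(Z) ⊆ S(Z̃)`
  since `π` is surjective"): a highest weight `χ^*` of `ℂ[Chow_n]` lifts to a highest-weight vector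
  `F` of `ℂ[Sym^n ℂ^n]` not vanishing on the orbit (complete reducibility,
  `exists_mem_highestWeightSpace_not_mem_of_hasHighestWeight`), a form of the degree `D` pinned by
  `|χ| = nD` (`isHomogeneous_of_mem_highestWeightSpace`); its pullback `F(ℓ_0⋯ℓ_{n-1})` is a nonzero
  highest-weight vector in `𝒪(V^n // H_n)_D`, so `χ ∈ symSymOcc n D` through `Ξ`;
* `S(V^n // H_n) ⊆ A(S(Chow_n))` (`normChowWeights_subset_closure_chowOccWeights`): a nonzero
  highest-weight vector of weight `χ^*` on `Sym^{|χ|/n} ℂ^n` is a form of degree `n` (degree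
  pinning; the degenerate inner degree `0` forces `χ = 0`), realised in `𝒪(V^n // H_n)` through `Θ`,
  and Brion's theorem applies;
* Lemma 6: the tree's explicit realisation `isRealized_genK` of the weight `psiK n k` in
  `𝒪(V^n // H_n)_k` by a symmetrised product of minors (`ChowHighestWeight.lean`, replacing the
  printed route through inheritance and Manivel–Michałek Cor. 6.4), the bridge `Ξ`, and the
  identification `(psiK n k)^* = lemma6Weight n k` of its dual with the printed partition
  `((n-k)k + k(k-1)/2 + 1, k(k-1)/2 + 1, 1^{k-2})` (`dual_psiK_eq_lemma6Weight`).

## References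

* [BurgisserHuttenhainIkenmeyer2017] §1 (after (1)), §2 (before Prop. 1: `S(Z) ⊆ S(Z̃)`), Prop. 1,
  §3 Lemmas 3–4, the sentence before Lemma 5, Lemma 6.
* M. Brion, Manuscripta Math. 80 (1993) 347–371 (finiteness of `ψ_n`), as used through
  `NotViaSaturationsThm3.lean`.
-/

noncomputable section

open MvPolynomial

namespace Literature.Barriers.ValiantsHypothesis

open Literature.NumberTheory.DiophantineGeometry Literature.Computability.AlgebraicComplexity
  Literature.Computability.Complexity

/-! ### BHI Prop. 1 for the Chow variety -/

variable {n : ℕ}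

/-- A highest-weight vector of `k[Sym^m k^n]` has the torus weight of each of its monomials; in
particular `|χ| = -m·D` for the degree `D` of any monomial in its support. [folklore] -/
theorem size_eq_neg_of_mem_highestWeightSpace_coordRep {m : ℕ} {χ : Weight (Fin n)}
    {F : MvPolynomial (DegIdx (Fin n) m) ℂ} (hF : F ∈ highestWeightSpace (coordRep (Fin n) ℂ m) χ)
    {s : DegIdx (Fin n) m →₀ ℕ} (hs : s ∈ F.support) : χ.size = -((m * s.degree : ℕ) : ℤ) := by
  rw [← monWeight_eq_of_mem_weightSpace (highestWeightSpace_le_weightSpace _ _ hF) hs]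
  exact size_monWeight s

/-- In inner degree `0` the only highest weight of `k[Sym^0 k^n]` is `0` (the torus acts trivially).
[folklore] -/
theorem eq_zero_of_mem_highestWeightSpace_coordRep_zero {χ : Weight (Fin n)}
    {F : MvPolynomial (DegIdx (Fin n) 0) ℂ} (hF : F ∈ highestWeightSpace (coordRep (Fin n) ℂ 0) χ)
    (hF0 : F ≠ 0) : χ = 0 := by
  obtain ⟨s, hs⟩ := support_nonempty.mpr hF0
  rw [← monWeight_eq_of_mem_weightSpace (highestWeightSpace_le_weightSpace _ _ hF) hs]
  funext i
  refine monWeight_apply_eq_zero s fun d _ => ?_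
  have hd : d.1.degree = 0 := mem_degMonomials_iff.mp d.2
  rw [Finsupp.degree_eq_zero_iff] at hd
  rw [hd, Finsupp.zero_apply]

/-- **Degree pinning and the bridge**: a nonzero highest-weight vector of weight `χ^*` in
`k[Sym^K ℂ^n]` with `|χ| = nK`, `K ≠ 0`, is a form of degree `n`, so `χ^*` is realised in
`𝒪(V^n // H_n)_K`. [cite: BurgisserHuttenhainIkenmeyer2017, Lemma 4] -/
theorem isRealized_dual_of_mem_highestWeightSpace {K : ℕ} (hK : K ≠ 0) {χ : Weight (Fin n)}
    {F : MvPolynomial (DegIdx (Fin n) K) ℂ}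
    (hF : F ∈ highestWeightSpace (coordRep (Fin n) ℂ K) χ.dual) (hF0 : F ≠ 0)
    (hsize : χ.size = ((n * K : ℕ) : ℤ)) : IsRealized ℂ n K χ.dual := by
  obtain ⟨s, hs⟩ := support_nonempty.mpr hF0
  have hs' := size_eq_neg_of_mem_highestWeightSpace_coordRep hF hs
  have hhom : F.IsHomogeneous s.degree := isHomogeneous_of_mem_highestWeightSpace hK hF hs'
  rw [Weight.size_dual, hsize, neg_inj, Nat.cast_inj] at hs'
  have hdeg : s.degree = n :=
    (Nat.eq_of_mul_eq_mul_left (Nat.pos_of_ne_zero hK) ((mul_comm K n).trans hs')).symm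
  rw [hdeg] at hhom
  exact isRealized_of_mem_highestWeightSpace_coordRep hF hhom hF0

/-- The size of a weight occurring (dually) in `k[Sym^K ℂ^n]` is nonnegative. [folklore] -/
theorem size_nonneg_of_mem_highestWeightSpace {K : ℕ} {χ : Weight (Fin n)}
    {F : MvPolynomial (DegIdx (Fin n) K) ℂ}
    (hF : F ∈ highestWeightSpace (coordRep (Fin n) ℂ K) χ.dual) (hF0 : F ≠ 0) : 0 ≤ χ.size := by
  obtain ⟨s, hs⟩ := support_nonempty.mpr hF0
  have hs' := size_eq_neg_of_mem_highestWeightSpace_coordRep hF hs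
  rw [Weight.size_dual, neg_inj] at hs'
  rw [hs']
  exact Int.natCast_nonneg _

/-- Arithmetic of Lemma 4's index: if `n ∣ |χ|` and `|χ| ≥ 0` then `|χ| = n · (|χ|/n)`. [folklore] -/
theorem size_eq_mul_div {χ : Weight (Fin n)} (h0 : 0 ≤ χ.size) (hdvd : (n : ℤ) ∣ χ.size) :
    χ.size = ((n * (χ.size.toNat / n) : ℕ) : ℤ) := by
  obtain ⟨q, hq⟩ := hdvd
  rcases Nat.eq_zero_or_pos n with hn | hn
  · subst hn
    rw [hq]
    simp
  · have hq0 : 0 ≤ q := by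
      by_contra hneg
      have : χ.size < 0 := by rw [hq]; nlinarith
      exact absurd h0 (not_le.mpr this)
    have h1 : χ.size.toNat = n * q.toNat := by
      zify
      rw [Int.toNat_of_nonneg h0, Int.toNat_of_nonneg hq0, hq]
    rw [h1, Nat.mul_div_cancel_left _ hn]
    push_cast
    rw [Int.toNat_of_nonneg hq0, hq]

/-- **`S(Chow_n) ⊆ S(V^n // H_n)`** ("Note that `S(Z) ⊆ S(Z̃)` since `π` is surjective", for the
normalisation `ψ_n : V^n // H_n → Chow_n`, with Lemma 4's description of `S(V^n // H_n)`): a highest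
weight `χ^*` of `k[Chow_n]` lifts to a highest-weight vector `F` of `k[Sym^n ℂ^n]` of some degree
`D` not vanishing on the orbit (`|χ| = nD`), whose pullback `F(ℓ_0⋯ℓ_{n-1})` is a nonzero
highest-weight vector in `𝒪(V^n // H_n)_D`, i.e. (through the bridge) `χ` occurs in
`Sym^n Sym^D ℂ^n`. [cite: BurgisserHuttenhainIkenmeyer2017, §2 (S(Z) ⊆ S(Z̃)) with Lemmas 3–4] -/
theorem chowOccWeights_subset_normChowWeights (hn : 0 < n) :
    (chowOccWeights n : Set (Weight (Fin n))) ⊆ normChowWeights n := by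
  intro χ hχ
  rw [SetLike.mem_coe, mem_chowOccWeights_iff] at hχ
  obtain ⟨F, hF, hFI⟩ :=
    exists_mem_highestWeightSpace_not_mem_of_hasHighestWeight (chowMonomial ℂ n) n hχ
  have hF0 : F ≠ 0 := fun h => hFI (h ▸ Ideal.zero_mem _)
  obtain ⟨s, hs⟩ := support_nonempty.mpr hF0
  have hsize := size_eq_neg_of_mem_highestWeightSpace_coordRep hF hs
  have hhom : F.IsHomogeneous s.degree := isHomogeneous_of_mem_highestWeightSpace hn.ne' hF hsize
  -- the pullback to `Mat_n`
  have hG0 : chowPullback n F ≠ 0 := (chowPullback_ne_zero_iff n).mpr hFI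
  have hGs : chowPullback n F ∈ symBalanced (k := ℂ) n s.degree :=
    chowPullback_mem_symBalanced_of_isHomogeneous n hhom
  have hGw : chowPullback n F ∈ highestWeightSpace (formsRep n) χ.dual :=
    highestWeightSpace_le_comap_intertwiningMap (chowPullbackIntertwining (k := ℂ) n) _ hF
  have hreal : IsRealized ℂ n s.degree χ.dual := ⟨_, hG0, hGs, hGw⟩
  obtain ⟨F', hF', -, hF'0⟩ := exists_mem_highestWeightSpace_coordRep_of_isRealized hreal
  have hocc : χ ∈ symSymOcc n s.degree :=
    (mem_symSymOcc_iff n _ χ).mpr ((hasHighestWeight_iff_exists _ _).mpr ⟨F', hF'0, hF'⟩)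
  refine mem_normChowWeights_of_size hn hocc ?_
  rw [Weight.size_dual] at hsize
  linarith

/-- **`S(V^n // H_n) ⊆ A(S(Chow_n))`** (Prop. 1: "`λ = μ - ν ∈ A(Z)`. This shows the equality for
the groups", for the normalisation of the Chow variety): a weight `χ` with `n ∣ |χ|` occurring in
`Sym^n Sym^{|χ|/n} ℂ^n` (a nonzero highest-weight vector of weight `χ^*` among the forms on
`Sym^{|χ|/n} ℂ^n`, necessarily of degree `n`) is realised in `𝒪(V^n // H_n)` through the bridge,
hence lies in `A(S(Chow_n))` by Brion's theorem (`mem_closure_chowOccWeights_of_isRealized`).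
[cite: BurgisserHuttenhainIkenmeyer2017, Prop. 1 with Lemmas 3–4 (§3, before Lemma 5)] -/
theorem normChowWeights_subset_closure_chowOccWeights (hn : 0 < n) :
    normChowWeights n ⊆ AddSubgroup.closure (chowOccWeights n : Set (Weight (Fin n))) := by
  intro χ hχ
  obtain ⟨hdvd, hocc⟩ := hχ
  generalize hK : χ.size.toNat / n = K at hocc
  rw [mem_symSymOcc_iff, hasHighestWeight_iff_exists] at hocc
  obtain ⟨F, hF0, hF⟩ := hocc
  by_cases hK0 : K = 0
  · subst hK0
    have hχ0 : χ = 0 := by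
      rw [← Weight.dual_dual χ, eq_zero_of_mem_highestWeightSpace_coordRep_zero hF hF0,
        Weight.dual_zero]
    rw [SetLike.mem_coe, hχ0]
    exact zero_mem _
  · have hsize : χ.size = ((n * K : ℕ) : ℤ) := by
      rw [← hK]
      exact size_eq_mul_div (size_nonneg_of_mem_highestWeightSpace hF hF0) hdvd
    have h := mem_closure_chowOccWeights_of_isRealized hn
      (isRealized_dual_of_mem_highestWeightSpace hK0 hF hF0 hsize)
    rwa [Weight.dual_dual] at h

/-- **BHI Prop. 1, group part, for the Chow variety — discharge of the named fact
`BHI2017_prop1_group`**: `A(S(Chow_n)) = A(S(V^n // H_n))` for `n ≥ 1`, with `S(V^n // H_n)`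
described by Lemma 4 (`normChowWeights n`). Both inclusions of generators:
`chowOccWeights_subset_normChowWeights` (`S(Z) ⊆ S(Z̃)`) and
`normChowWeights_subset_closure_chowOccWeights` (Prop. 1 via Brion's theorem).
[cite: BurgisserHuttenhainIkenmeyer2017, Prop. 1 with Lemmas 3–4 (§3, before Lemma 5)] -/
theorem BHI2017_prop1_group_holds : BHI2017_prop1_group := fun _ hn =>
  le_antisymm
    ((AddSubgroup.closure_le _).mpr fun _ hχ =>
      AddSubgroup.subset_closure (chowOccWeights_subset_normChowWeights hn hχ))
    ((AddSubgroup.closure_le _).mpr (normChowWeights_subset_closure_chowOccWeights hn))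

/-! ### BHI Lemma 6 -/

/-- Duals of finset sums of weights. [folklore] -/
theorem _root_.Literature.NumberTheory.DiophantineGeometry.Weight.dual_sum {N : ℕ} {ι : Type*}
    (S : Finset ι) (χ : ι → Weight (Fin N)) : (∑ i ∈ S, χ i).dual = ∑ i ∈ S, (χ i).dual := by
  classical
  induction S using Finset.induction_on with
  | empty => rw [Finset.sum_empty, Finset.sum_empty, Weight.dual_zero]
  | insert a S ha ih => rw [Finset.sum_insert ha, Finset.sum_insert ha, Weight.dual_add, ih]

/-- The number of pairs `a < b` in `Fin K` is `K(K-1)/2`. [folklore] -/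
theorem sum_card_Ioi_fin (K : ℕ) : ∑ a : Fin K, (Finset.Ioi a).card = K * (K - 1) / 2 := by
  simp_rw [Fin.card_Ioi]
  rw [Fin.sum_univ_eq_sum_range (fun a => K - 1 - a) K, Finset.sum_range_reflect (fun a => a) K,
    Finset.sum_range_id]

/-- The number of indices `j ∈ Fin n` with `K ≤ j` is `n - K` (`K ≤ n`). [folklore] -/
theorem card_filter_le_fin {K : ℕ} (hK : K ≤ n) :
    (Finset.univ.filter fun j : Fin n => K ≤ (j : ℕ)).card = n - K := by
  have hlt : (Finset.univ.filter fun j : Fin n => (j : ℕ) < K).card = K := by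
    have himg : (Finset.univ.filter fun j : Fin n => (j : ℕ) < K) =
        Finset.univ.image (Fin.castLE hK) := by
      ext j
      simp only [Finset.mem_filter, Finset.mem_univ, true_and, Finset.mem_image]
      constructor
      · intro hj
        exact ⟨⟨j, hj⟩, Fin.ext rfl⟩
      · rintro ⟨a, rfl⟩
        exact a.2
    rw [himg, Finset.card_image_of_injective _ (Fin.castLE_injective hK), Finset.card_univ,
      Fintype.card_fin]
  have h := Finset.card_filter_add_card_filter_not
    (s := (Finset.univ : Finset (Fin n))) (fun j : Fin n => (j : ℕ) < K)
  rw [hlt, Finset.card_univ, Fintype.card_fin] at h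
  have h' : (Finset.univ.filter fun j : Fin n => ¬ (j : ℕ) < K) =
      Finset.univ.filter fun j : Fin n => K ≤ (j : ℕ) :=
    Finset.filter_congr fun j _ => not_lt
  rw [h'] at h
  omega

/-- **The dual coordinates of `psiK` in the first two rows**: `1 + K(K-1)/2 + [i = 0](n-K)K`.
[cite: BurgisserHuttenhainIkenmeyer2017, Lemma 6] -/
theorem dual_psiK_apply_of_lt_two {K : ℕ} (h2 : 2 ≤ K) (hK : K ≤ n) (i : Fin n) (hi : (i : ℕ) < 2) :
    (psiK n K).dual i = 1 + ((K * (K - 1) / 2 : ℕ) : ℤ) +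
      if (i : ℕ) = 0 then (((n - K) * K : ℕ) : ℤ) else 0 := by
  have hn2 : 2 ≤ n := le_trans h2 hK
  have hn1 : 1 ≤ n := le_trans one_le_two hn2
  rw [psiK, Weight.dual_add, Weight.dual_add, Weight.dual_sum, Weight.dual_sum, dual_lastWeight n hK]
  simp only [Pi.add_apply, Finset.sum_apply, Weight.dual_sum, Weight.dual_nsmul, Pi.smul_apply,
    dual_lastWeight n hn2, dual_lastWeight n hn1, fundWeight_apply]
  rw [if_pos (show (i : ℕ) < K by omega), if_pos hi]
  simp only [Finset.sum_const, card_filter_le_fin hK, Nat.lt_one_iff, nsmul_eq_mul, mul_one]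
  rw [← Nat.cast_sum, sum_card_Ioi_fin K]
  split_ifs <;> push_cast <;> ring

/-- **The dual of `psiK` is Lemma 6's partition**: `(psiK n K)^* = λ^{(K)} = lemma6Weight n K`
(`2 ≤ K ≤ n`): `((n-K)K + K(K-1)/2 + 1, K(K-1)/2 + 1, 1^{K-2}, 0^{n-K})`.
[cite: BurgisserHuttenhainIkenmeyer2017, Lemma 6] -/
theorem dual_psiK_eq_lemma6Weight {K : ℕ} (h2 : 2 ≤ K) (hK : K ≤ n) :
    (psiK n K).dual = lemma6Weight n K := by
  funext i
  by_cases hi : 2 ≤ (i : ℕ)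
  · rw [dual_psiK_apply_of_two_le n hK i hi, lemma6Weight_apply_of_two_le i hi]
  · have hψ := dual_psiK_apply_of_lt_two h2 hK i (by omega)
    have hcol : columnTailWeight n K i = 0 := by
      rw [columnTailWeight_apply, if_neg (by omega)]
    rw [hψ, lemma6Weight, Pi.add_apply, hcol, add_zero, twoRowWeight_apply]
    by_cases h0 : (i : ℕ) = 0
    · rw [if_pos h0, if_pos h0]
      push_cast
      ring
    · have h1 : (i : ℕ) = 1 := by omega
      rw [if_neg h0, if_neg h0, if_pos h1]
      push_cast
      ring

/-- **BHI Lemma 6 — discharge of the named fact `BHI2017_lemma6`**: "the partition `λ` [`= λ^{(k)}`]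
occurs in `Sym^n Sym^k V`" (`2 ≤ k ≤ n`). The tree realises the dual weight `psiK n k` by the explicit
symmetrised product of minors `genK` in `𝒪(V^n // H_n)_k` (`isRealized_genK`, replacing the printed
route through inheritance and Manivel–Michałek Cor. 6.4); the plethysm bridge carries it to a
highest-weight vector among the forms of degree `n` on `Sym^k ℂ^n`, and `(psiK n k)^* = lemma6Weight n k`
(`dual_psiK_eq_lemma6Weight`). [cite: BurgisserHuttenhainIkenmeyer2017, Lemma 6] -/
theorem BHI2017_lemma6_holds : BHI2017_lemma6 := by
  intro n K h2 hK
  obtain ⟨F, hF, -, hF0⟩ :=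
    exists_mem_highestWeightSpace_coordRep_of_isRealized (isRealized_genK ℂ n h2 hK)
  rw [mem_symSymOcc_iff, ← dual_psiK_eq_lemma6Weight h2 hK, Weight.dual_dual,
    hasHighestWeight_iff_exists]
  exact ⟨F, hF0, hF⟩

end Literature.Barriers.ValiantsHypothesis
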